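import Literature.NumberTheory.Sieve.FordMaynardFragmentation
import Literature.NumberTheory.Sieve.FordMaynardPolyLip
import HarnessLib

/-!
# The integrand of the fragmentation relation (6.3) is polytopal-Lipschitz

Structure of the integrand `fragIntegrand γ η N g (k₁,…,k_m) ξ U` of Ford–Maynard's fragmentation
operator (`fragOp`, the right-hand side of (6.3)/(fsl) of K. Ford, J. Maynard, arXiv:2407.14368,
§6.1) as a function of ALL its variables `(ξ, U) ∈ ℝ^m × ℝ^{m × N}`. Everything here is PROVED.

* The maps `(ξ, U) ↦ u_j = blockVec k_j ξ_j (row j of U)` (`blockLinear`) and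
  `(ξ, U) ↦ (u₁, …, u_m)` (`fragLinear`), and the coordinates of the rows (`rowFunctional`), are
  LINEAR; the admissibility condition `BlockCond` of all blocks is a POLYHEDRAL condition
  (`isPolyhedral_blockCond`, `isPolyhedral_allBlockCond`).
* `polyLip_linnikFn` — the Linnik function `x ↦ 𝓛_c(x_A)` ((Linnik-fcn), §5.1) is a finite linear
  combination of products of indicators of open half-spaces `{∑_{i∈B} x_i < c}`, hence `PolyLip`;
  `polyLip_indicator_blockWeight` — the block weight `𝓛_{1−γ}(v)/(k! v₁⋯v_k)` cut off to
  `{v ≥ η}` is `PolyLip` (`1/v_i` is Lipschitz and bounded on `[η, ∞)`).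
* `polyLip_fragIntegrand` — consequently `(ξ, U) ↦ fragIntegrand γ η N g k ξ U ∈ PolyLip` as soon as
  `g|ℝ^{k₁+⋯+k_m} ∈ PolyLip` (e.g. piecewise Lipschitz, Definition 6.2 (b));
  `fragIntegrand_support` — it vanishes unless `|ξ_j| ≤ N R` and `|U_{j,i}| ≤ max(R, 1)`, when
  `g|ℝ^{k₁+⋯+k_m}` is supported in the box of radius `R`.

These feed the fibre-integration lemma (`FordMaynardFibreIntegral.lean`) in
`FordMaynardFragmentationProofs.lean`.

## References

* K. Ford, J. Maynard, *On the theory of prime producing sieves*, arXiv:2407.14368v1 (2024), §5.1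
  (Linnik-fcn), §6.1 (6.3), Theorem 6.4 (fsl), Definition 6.2 (b). [FordMaynard2024PrimeSieves]
-/

noncomputable section

open Set Finset Literature.Combinatorics.Enumerative

namespace Literature.NumberTheory.Sieve.FordMaynard

/-! ### The Linnik function and the block weight are polytopal-Lipschitz -/

section Weights

variable {k : ℕ}

/-- The indicator `N_{x,c}(B) = [B ≠ ∅ ∧ ∑_{i∈B} x_i < c]` is, as a function of `x`, the indicator of
an open half-space (or zero). [cite: FordMaynard2024PrimeSieves, Def. (Linnik-fcn), §5.1] -/
theorem polyLip_smallFn (c : ℝ) (B : Finset (Fin k)) :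
    PolyLip (fun x : Fin k → ℝ => smallFn c x B) := by
  by_cases hB : B.Nonempty
  · have hQ : IsPolyhedral {x : Fin k → ℝ | ∑ i ∈ B, x i < c} := by
      have := isPolyhedral_lt (∑ i ∈ B, coordFunctional i) c
      convert this using 1
      ext x
      simp only [Set.mem_setOf_eq, LinearMap.coe_sum, Finset.sum_apply, coordFunctional_apply]
    refine (PolyLip.indicator_one hQ).congr fun x => ?_
    unfold smallFn
    by_cases hx : ∑ i ∈ B, x i < c
    · rw [if_pos ⟨hB, hx⟩, Set.indicator_of_mem (show x ∈ {x : Fin k → ℝ | ∑ i ∈ B, x i < c} from hx)]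
    · rw [if_neg (fun h => hx h.2),
        Set.indicator_of_notMem (show x ∉ {x : Fin k → ℝ | ∑ i ∈ B, x i < c} from hx)]
  · refine (PolyLip.const 0).congr fun x => ?_
    unfold smallFn
    rw [if_neg (fun h => hB h.1)]

/-- The convolution powers `N_{x,c}^{⋆n}(A)` (counting ordered decompositions of `x_A` into `n`
small subvectors) are, as functions of `x`, finite sums of products of half-space indicators.
[cite: FordMaynard2024PrimeSieves, Def. (Linnik-fcn), §5.1] -/
theorem polyLip_spow_smallFn (c : ℝ) :
    ∀ (n : ℕ) (A : Finset (Fin k)), PolyLip (fun x : Fin k → ℝ => spow (smallFn c x) n A)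
  | 0, A => by
    simp only [spow_zero]
    exact PolyLip.const _
  | n + 1, A => by
    simp only [spow_succ, sconv]
    exact PolyLip.finset_sum _ fun B _ =>
      (polyLip_smallFn c B).mul (polyLip_spow_smallFn c n (A \ B))

/-- **The Linnik function is polytopal-Lipschitz**: `x ↦ 𝓛_c(x_A)` is a finite linear combination of
products of indicators of open half-spaces. [cite: FordMaynard2024PrimeSieves, Def. (Linnik-fcn), §5.1] -/
theorem polyLip_linnikFn (c : ℝ) (A : Finset (Fin k)) :
    PolyLip (fun x : Fin k → ℝ => linnikFn c x A) := by
  unfold linnikFn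
  exact PolyLip.finset_sum _ fun j _ => (polyLip_spow_smallFn c j A).const_mul (wLinnik j)

/-- On `{v | ∀ i, η ≤ v_i}` (`η > 0`) the function `v ↦ 1/v_i` is Lipschitz (constant `η⁻²`) and
bounded (by `η⁻¹`), so its cut-off is `PolyLip`. [folklore] -/
theorem polyLip_indicator_inv {η : ℝ} (hη : 0 < η) (i : Fin k) :
    PolyLip ({v : Fin k → ℝ | ∀ i, η ≤ v i}.indicator fun v => (v i)⁻¹) := by
  refine PolyLip.of_indicator (IsPolyhedral.setOf_forall fun i => ?_)
    (K := Real.toNNReal (η⁻¹ * η⁻¹)) ?_ (M := η⁻¹) ?_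
  · simpa using isPolyhedral_ge (coordFunctional i) η
  · refine LipschitzOnWith.of_dist_le' fun v hv w hw => ?_
    have hv' : η ≤ v i := hv i
    have hw' : η ≤ w i := hw i
    have hv0 : 0 < v i := hη.trans_le hv'
    have hw0 : 0 < w i := hη.trans_le hw'
    have hdist : |w i - v i| ≤ dist v w := by
      rw [abs_sub_comm, dist_eq_norm, ← Real.norm_eq_abs]
      exact norm_le_pi_norm (v - w) i
    rw [Real.dist_eq, inv_sub_inv hv0.ne' hw0.ne', abs_div, abs_of_pos (mul_pos hv0 hw0)]
    calc |w i - v i| / (v i * w i) ≤ |w i - v i| / (η * η) :=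
          div_le_div_of_nonneg_left (abs_nonneg _) (mul_pos hη hη) (mul_le_mul hv' hw' hη.le hv0.le)
      _ ≤ dist v w / (η * η) := by gcongr
      _ = η⁻¹ * η⁻¹ * dist v w := by rw [div_eq_mul_inv, mul_inv, mul_comm]
  · intro v hv
    have := hv i
    rw [abs_inv, abs_of_pos (hη.trans_le this)]
    exact inv_anti₀ hη this

/-- The cut-off inverse product `𝟙{v ≥ η} / (v₁⋯v_k)` is `PolyLip` (a product of the previous).
[folklore] -/
theorem polyLip_indicator_prod_inv {η : ℝ} (hη : 0 < η) (k : ℕ) :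
    PolyLip ({v : Fin k → ℝ | ∀ i, η ≤ v i}.indicator fun v => ∏ i, (v i)⁻¹) := by
  have h := PolyLip.finset_prod Finset.univ (fun i _ => polyLip_indicator_inv (k := k) hη i)
  refine h.congr fun v => ?_
  by_cases hv : v ∈ {v : Fin k → ℝ | ∀ i, η ≤ v i}
  · simp only [Set.indicator_of_mem hv]
  · rw [Set.indicator_of_notMem hv]
    obtain ⟨i, -⟩ : ∃ i : Fin k, ¬ η ≤ v i := by simpa using hv
    exact Finset.prod_eq_zero (Finset.mem_univ i) (Set.indicator_of_notMem hv _)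

/-- **The block weight is polytopal-Lipschitz**: `𝟙{v ≥ η} · 𝓛_{1−γ}(v)/(k! v₁⋯v_k) ∈ PolyLip`.
[cite: FordMaynard2024PrimeSieves, §6.1 (6.3)] -/
theorem polyLip_indicator_blockWeight (γ : ℝ) {η : ℝ} (hη : 0 < η) (k : ℕ) :
    PolyLip ({v : Fin k → ℝ | ∀ i, η ≤ v i}.indicator (blockWeight γ k)) := by
  have h := (polyLip_linnikFn (k := k) (1 - γ) Finset.univ).mul
    ((polyLip_indicator_prod_inv hη k).const_mul ((k.factorial : ℝ)⁻¹))
  refine h.congr fun v => ?_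
  by_cases hv : v ∈ {v : Fin k → ℝ | ∀ i, η ≤ v i}
  · rw [Set.indicator_of_mem hv, Set.indicator_of_mem hv, blockWeight, div_eq_mul_inv, mul_inv,
      Finset.prod_inv_distrib]
  · simp [Set.indicator_of_notMem hv]

end Weights

/-! ### The linear structure maps of (6.3) -/

section Maps

variable {m N : ℕ}

/-- Rows are additive. [folklore] -/
theorem rowOf_add (U V : Fin m × Fin N → ℝ) (j : Fin m) : rowOf (U + V) j = rowOf U j + rowOf V j := by
  funext i
  simp only [rowOf, Pi.add_apply]
  split_ifs <;> simp

/-- Rows are homogeneous. [folklore] -/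
theorem rowOf_smul (a : ℝ) (U : Fin m × Fin N → ℝ) (j : Fin m) : rowOf (a • U) j = a • rowOf U j := by
  funext i
  simp only [rowOf, Pi.smul_apply, smul_eq_mul]
  split_ifs <;> simp

/-- Blocks are additive in (sum, coordinates). [folklore] -/
theorem blockVec_add (k : ℕ) (α β : ℝ) (u v : ℕ → ℝ) :
    blockVec k (α + β) (u + v) = blockVec k α u + blockVec k β v := by
  funext i
  simp only [blockVec, Pi.add_apply]
  split_ifs
  · rfl
  · rw [Finset.sum_add_distrib]; ring

/-- Blocks are homogeneous in (sum, coordinates). [folklore] -/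
theorem blockVec_smul (k : ℕ) (a α : ℝ) (u : ℕ → ℝ) :
    blockVec k (a * α) (a • u) = a • blockVec k α u := by
  funext i
  simp only [blockVec, Pi.smul_apply, smul_eq_mul]
  split_ifs
  · rfl
  · rw [← Finset.mul_sum]; ring

/-- The coordinate `(ξ, U) ↦ (row j of U)_i` of the flat space `ℝ^m × ℝ^{m × N}` (zero for
`i ≥ N`), a linear functional. [cite: FordMaynard2024PrimeSieves, §6.1 (6.3)] -/
def rowFunctional (m N : ℕ) (j : Fin m) (i : ℕ) : ((Fin m → ℝ) × (Fin m × Fin N → ℝ)) →ₗ[ℝ] ℝ where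
  toFun p := rowOf p.2 j i
  map_add' p q := by rw [Prod.snd_add, rowOf_add, Pi.add_apply]
  map_smul' a p := by rw [Prod.smul_snd, rowOf_smul, Pi.smul_apply, RingHom.id_apply]

/-- `rowFunctional m N j i (ξ, U) = rowOf U j i`. [folklore] -/
@[simp] theorem rowFunctional_apply (j : Fin m) (i : ℕ) (p : (Fin m → ℝ) × (Fin m × Fin N → ℝ)) :
    rowFunctional m N j i p = rowOf p.2 j i := rfl

/-- The component `(ξ, U) ↦ ξ_j`, a linear functional. [folklore] -/
def fstFunctional (m N : ℕ) (j : Fin m) : ((Fin m → ℝ) × (Fin m × Fin N → ℝ)) →ₗ[ℝ] ℝ :=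
  (LinearMap.proj j).comp (LinearMap.fst ℝ (Fin m → ℝ) (Fin m × Fin N → ℝ))

/-- `fstFunctional m N j (ξ, U) = ξ_j`. [folklore] -/
@[simp] theorem fstFunctional_apply (j : Fin m) (p : (Fin m → ℝ) × (Fin m × Fin N → ℝ)) :
    fstFunctional m N j p = p.1 j := rfl

/-- **The block map** `(ξ, U) ↦ u_j = blockVec k ξ_j (row j of U) ∈ ℝ^k` of (6.3) (first `k − 1`
coordinates free, the last one `ξ_j −` their sum), a linear map. [cite: FordMaynard2024PrimeSieves, §6.1 (6.3)] -/
def blockLinear (m N k : ℕ) (j : Fin m) : ((Fin m → ℝ) × (Fin m × Fin N → ℝ)) →ₗ[ℝ] (Fin k → ℝ) where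
  toFun p := blockVec k (p.1 j) (rowOf p.2 j)
  map_add' p q := by rw [Prod.fst_add, Prod.snd_add, Pi.add_apply, rowOf_add, blockVec_add]
  map_smul' a p := by
    rw [Prod.smul_fst, Prod.smul_snd, Pi.smul_apply, rowOf_smul, smul_eq_mul, blockVec_smul,
      RingHom.id_apply]

/-- `blockLinear m N k j (ξ, U) = blockVec k ξ_j (rowOf U j)`. [folklore] -/
@[simp] theorem blockLinear_apply (k : ℕ) (j : Fin m) (p : (Fin m → ℝ) × (Fin m × Fin N → ℝ)) :
    blockLinear m N k j p = blockVec k (p.1 j) (rowOf p.2 j) := rfl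

/-- **The fragmentation map** `(ξ, U) ↦ (u₁, …, u_m) ∈ ℝ^{k₁ + ⋯ + k_m}` of (6.3), the concatenation
of the blocks, a linear map. [cite: FordMaynard2024PrimeSieves, §6.1 (6.3)] -/
def fragLinear (m N : ℕ) (kv : Fin m → ℕ) :
    ((Fin m → ℝ) × (Fin m × Fin N → ℝ)) →ₗ[ℝ] (Fin (∑ j, kv j) → ℝ) where
  toFun p := concatBlocks kv fun j => blockLinear m N (kv j) j p
  map_add' p q := by
    funext t
    simp only [concatBlocks, map_add, Pi.add_apply]
  map_smul' a p := by
    funext t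
    simp only [concatBlocks, map_smul, Pi.smul_apply, RingHom.id_apply]

/-- `fragLinear m N kv (ξ, U) = concatBlocks kv (u_j)`. [folklore] -/
@[simp] theorem fragLinear_apply (kv : Fin m → ℕ) (p : (Fin m → ℝ) × (Fin m × Fin N → ℝ)) :
    fragLinear m N kv p = concatBlocks kv fun j => blockVec (kv j) (p.1 j) (rowOf p.2 j) := rfl

/-! ### Admissibility is a polyhedral condition -/

/-- A condition on natural numbers below `k` quantified over `ℕ` is a condition quantified over
`Fin k`. [folklore] -/
theorem forall_nat_lt_iff {k : ℕ} {P : ℕ → Prop} :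
    (∀ i : ℕ, i + 1 < k → P i) ↔ ∀ i : Fin k, (i : ℕ) + 1 < k → P i :=
  ⟨fun h i hi => h i hi, fun h i hi => h ⟨i, by omega⟩ hi⟩

/-- A condition on natural numbers below `N` quantified over `ℕ` is a condition quantified over
`Fin N`. [folklore] -/
theorem forall_nat_lt_iff' {N : ℕ} {c : ℕ → Prop} {P : ℕ → Prop} :
    (∀ i : ℕ, c i → i < N → P i) ↔ ∀ i : Fin N, c i → P i :=
  ⟨fun h i hi => h i hi i.2, fun h i hi hiN => h ⟨i, hiN⟩ hi⟩

/-- **Admissibility of block `j` is polyhedral**: `{(ξ, U) | BlockCond η N k ξ_j (row j of U)}` is a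
finite intersection of open and closed half-spaces of `ℝ^m × ℝ^{m × N}`.
[cite: FordMaynard2024PrimeSieves, §6.1 (6.3)] -/
theorem isPolyhedral_blockCond (η : ℝ) (m N k : ℕ) (j : Fin m) :
    IsPolyhedral {p : (Fin m → ℝ) × (Fin m × Fin N → ℝ) | BlockCond η N k (p.1 j) (rowOf p.2 j)} := by
  have h1 : IsPolyhedral {p : (Fin m → ℝ) × (Fin m × Fin N → ℝ) |
      ∀ i : ℕ, i + 1 < k → 0 < rowOf p.2 j i} := by
    have : IsPolyhedral {p : (Fin m → ℝ) × (Fin m × Fin N → ℝ) |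
        ∀ i : Fin k, (i : ℕ) + 1 < k → 0 < rowFunctional m N j i p} :=
      IsPolyhedral.setOf_forall fun i => IsPolyhedral.setOf_imp (isPolyhedral_gt _ _)
    convert this using 1
    ext p
    simp only [Set.mem_setOf_eq, rowFunctional_apply]
    exact forall_nat_lt_iff
  have h2 : IsPolyhedral {p : (Fin m → ℝ) × (Fin m × Fin N → ℝ) |
      ∑ i ∈ Finset.range (k - 1), rowOf p.2 j i < p.1 j} := by
    have := isPolyhedral_lt₂ (∑ i ∈ Finset.range (k - 1), rowFunctional m N j i) (fstFunctional m N j)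
    convert this using 1
    ext p
    simp only [Set.mem_setOf_eq, LinearMap.coe_sum, Finset.sum_apply, rowFunctional_apply,
      fstFunctional_apply]
  have h3 : IsPolyhedral {p : (Fin m → ℝ) × (Fin m × Fin N → ℝ) |
      ∀ i : ℕ, k - 1 ≤ i → i < N → 0 < rowOf p.2 j i ∧ rowOf p.2 j i < 1} := by
    have : IsPolyhedral {p : (Fin m → ℝ) × (Fin m × Fin N → ℝ) |
        ∀ i : Fin N, k - 1 ≤ (i : ℕ) → 0 < rowFunctional m N j i p ∧ rowFunctional m N j i p < 1} :=
      IsPolyhedral.setOf_forall fun i => IsPolyhedral.setOf_imp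
        ((isPolyhedral_gt _ _).setOf_and (isPolyhedral_lt _ _))
    convert this using 1
    ext p
    simp only [Set.mem_setOf_eq, rowFunctional_apply]
    exact forall_nat_lt_iff' (c := fun i => k - 1 ≤ i) (P := fun i => 0 < rowOf p.2 j i ∧ rowOf p.2 j i < 1)
  have h4 : IsPolyhedral {p : (Fin m → ℝ) × (Fin m × Fin N → ℝ) |
      ∀ i : Fin k, η ≤ blockVec k (p.1 j) (rowOf p.2 j) i} :=
    IsPolyhedral.setOf_forall fun i => by
      simpa using isPolyhedral_ge ((LinearMap.proj i).comp (blockLinear m N k j)) η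
  have := h1.setOf_and (h2.setOf_and (h3.setOf_and h4))
  simpa only [BlockCond] using this

/-- Admissibility of all blocks is polyhedral. [cite: FordMaynard2024PrimeSieves, §6.1 (6.3)] -/
theorem isPolyhedral_allBlockCond (η : ℝ) (m N : ℕ) (kv : Fin m → ℕ) :
    IsPolyhedral {p : (Fin m → ℝ) × (Fin m × Fin N → ℝ) |
      ∀ j, BlockCond η N (kv j) (p.1 j) (rowOf p.2 j)} :=
  IsPolyhedral.setOf_forall fun j => isPolyhedral_blockCond η m N (kv j) j

end Maps

/-! ### The integrand of (6.3) -/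

section Integrand

variable {γ η : ℝ} {m N : ℕ}

/-- The integrand of (6.3) as "indicator of the admissible polyhedron × (product of cut-off block
weights) × `g` at the fragmentation", all composed with the linear structure maps.
[cite: FordMaynard2024PrimeSieves, §6.1 (6.3)] -/
theorem fragIntegrand_eq_indicator (γ η : ℝ) (N : ℕ) (g : VecFn) (kv : Fin m → ℕ)
    (p : (Fin m → ℝ) × (Fin m × Fin N → ℝ)) :
    fragIntegrand γ η N g kv p.1 p.2 =
      {p : (Fin m → ℝ) × (Fin m × Fin N → ℝ) |
          ∀ j, BlockCond η N (kv j) (p.1 j) (rowOf p.2 j)}.indicator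
        (fun p => (∏ j, {v : Fin (kv j) → ℝ | ∀ i, η ≤ v i}.indicator (blockWeight γ (kv j))
            (blockLinear m N (kv j) j p)) * g (∑ j, kv j) (fragLinear m N kv p)) p := by
  unfold fragIntegrand
  split_ifs with hc
  · rw [Set.indicator_of_mem (show p ∈ {p : (Fin m → ℝ) × (Fin m × Fin N → ℝ) |
        ∀ j, BlockCond η N (kv j) (p.1 j) (rowOf p.2 j)} from hc)]
    simp only [blockLinear_apply, fragLinear_apply]
    congr 1
    refine Finset.prod_congr rfl fun j _ => ?_
    rw [Set.indicator_of_mem]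
    exact fun i => (hc j).le_blockVec i
  · rw [Set.indicator_of_notMem (show p ∉ {p : (Fin m → ℝ) × (Fin m × Fin N → ℝ) |
        ∀ j, BlockCond η N (kv j) (p.1 j) (rowOf p.2 j)} from hc)]

/-- **The integrand of (6.3) is polytopal-Lipschitz in all variables**: if the restriction of `g`
to `ℝ^{k₁+⋯+k_m}` is `PolyLip` (e.g. piecewise Lipschitz on convex polytopes, Definition 6.2 (b))
and `η > 0`, then `(ξ, U) ↦ fragIntegrand γ η N g (k_j) ξ U ∈ PolyLip(ℝ^m × ℝ^{m × N})`.
[cite: FordMaynard2024PrimeSieves, §6.1 (6.3) and Definition 6.2 (b)] -/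
theorem polyLip_fragIntegrand (γ : ℝ) (hη : 0 < η) (N : ℕ) {g : VecFn} (kv : Fin m → ℕ)
    (hg : PolyLip (g (∑ j, kv j))) :
    PolyLip (fun p : (Fin m → ℝ) × (Fin m × Fin N → ℝ) => fragIntegrand γ η N g kv p.1 p.2) := by
  have h1 : PolyLip (fun p : (Fin m → ℝ) × (Fin m × Fin N → ℝ) =>
      (∏ j, {v : Fin (kv j) → ℝ | ∀ i, η ≤ v i}.indicator (blockWeight γ (kv j))
        (blockLinear m N (kv j) j p)) * g (∑ j, kv j) (fragLinear m N kv p)) :=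
    (PolyLip.finset_prod _ fun j _ =>
      (polyLip_indicator_blockWeight γ hη (kv j)).comp (blockLinear m N (kv j) j)).mul
      (hg.comp (fragLinear m N kv))
  exact (h1.indicator (isPolyhedral_allBlockCond η m N kv)).congr fun p =>
    (fragIntegrand_eq_indicator γ η N g kv p).symm

/-- **Support of the integrand of (6.3).** If `g|ℝ^{k₁+⋯+k_m}` vanishes outside the box of radius
`R ≥ 0` and `1 ≤ k_j ≤ N`, then `fragIntegrand γ η N g k ξ U ≠ 0` forces `|ξ_j| ≤ N R` (each `ξ_j` is
the sum of the `k_j ≤ N` entries of its block) and `|U_{j,i}| ≤ max(R, 1)` (free coordinates are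
block entries, dummy coordinates lie in `(0, 1)`). [cite: FordMaynard2024PrimeSieves, §6.1 (6.3)] -/
theorem fragIntegrand_support {g : VecFn} {kv : Fin m → ℕ} {R : ℝ} (hR : 0 ≤ R)
    (hkv : ∀ j, 1 ≤ kv j) (hkvN : ∀ j, kv j ≤ N)
    (hg : ∀ w, g (∑ j, kv j) w ≠ 0 → ∀ t, |w t| ≤ R) (ξ : Fin m → ℝ) (U : Fin m × Fin N → ℝ)
    (h : fragIntegrand γ η N g kv ξ U ≠ 0) :
    (∀ j, |ξ j| ≤ N * R) ∧ ∀ q, |U q| ≤ max R 1 := by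
  unfold fragIntegrand at h
  split_ifs at h with hc
  · have hg' := hg _ (right_ne_zero_of_mul h)
    have hv : ∀ (j) (i : Fin (kv j)), |blockVec (kv j) (ξ j) (rowOf U j) i| ≤ R := fun j i => by
      have := hg' (finSigmaFinEquiv ⟨j, i⟩)
      rwa [concatBlocks_apply_equiv] at this
    refine ⟨fun j => ?_, fun q => ?_⟩
    · rw [← sum_blockVec (hkv j) (ξ j) (rowOf U j)]
      calc |∑ i, blockVec (kv j) (ξ j) (rowOf U j) i|
          ≤ ∑ i, |blockVec (kv j) (ξ j) (rowOf U j) i| := Finset.abs_sum_le_sum_abs _ _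
        _ ≤ ∑ _i : Fin (kv j), R := Finset.sum_le_sum fun i _ => hv j i
        _ = kv j * R := by simp
        _ ≤ N * R := mul_le_mul_of_nonneg_right (by exact_mod_cast hkvN j) hR
    · obtain ⟨j, i⟩ := q
      by_cases hi : (i : ℕ) + 1 < kv j
      · have h1 : blockVec (kv j) (ξ j) (rowOf U j) ⟨i, by omega⟩ = U (j, i) := by
          simp [blockVec, rowOf, hi, i.2]
        have := hv j ⟨i, by omega⟩
        rw [h1] at this
        exact this.trans (le_max_left _ _)
      · have := (hc j).2.2.1 i (by omega) i.2
        have h2 : rowOf U j i = U (j, i) := by simp [rowOf, i.2]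
        rw [h2] at this
        rw [abs_le]
        constructor <;> linarith [le_max_right R 1, le_max_left R 1, this.1, this.2]
  · exact absurd rfl h

end Integrand

end Literature.NumberTheory.Sieve.FordMaynard
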